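import Literature.AlgebraicGeometry.Frobenioids.ModelFrobenioidRationalFunctions
import Literature.AlgebraicGeometry.Frobenioids.ModelFrobenioidAmpleness
import Literature.AlgebraicGeometry.Frobenioids.ModelFrobenioidBirational
import Literature.AlgebraicGeometry.Frobenioids.ModelFrobenioidCofinal
import Literature.AlgebraicGeometry.Frobenioids.ModelFrobenioidPreFrobenioid
import HarnessLib

/-!
# Frobenioids I, Theorem 5.2 (ii), last sentence — PROOF: the rational function monoid of a model
# Frobenioid is `B`

Mochizuki, *The geometry of Frobenioids I: the general theory*, Kyushu J. Math. **62** (2008)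
293–400, §5, Theorem 5.2 (ii), kurims text p. 101 (proof pp. 101–102)
[cite: MochizukiFrdI2008, Thm. 5.2(ii) p.101]:

  "Moreover, there is a natural isomorphism of functors between the functor "`O^×(−)`" on `D`
  associated to the Frobenioid `C^birat` [cf. Propositions 2.2, (ii), (iii); 4.4, (ii)] and the
  functor `B`; this isomorphism is compatible with the homomorphisms `O^×(−) → Φ^gp`
  [cf. Proposition 4.4, (iii)], `Div_B : B → Φ^gp`."

This file DISCHARGES `ModelFrobenioid.RationalFunctionMonoidIsB Φ B DivB`
(`ModelFrobenioidRationalFunctions.lean`, seat abc-iut-L1-t2): `rationalFunctionMonoidIsB_holds`.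

**Proof.** A rational function at `A = (A_D, α)` is a fraction `(δ, ν)` of base-equivalent
co-angular pre-steps `δ, ν : (Y_D, y) → A` (`PreFrobenioid.RatFrac`, file `BiratUnits.lean`); in the
model Frobenioid both have Frobenius degree `1` and the same base isomorphism `f : Y_D ⥲ A_D`, so
"`ν ∘ δ⁻¹`" has a well-defined unit part `B(f)⁻¹(u_ν · u_δ⁻¹) ∈ B(A_D)` (`ratUnit`; the element is
characterised by `B(f)(r) · u_δ = u_ν`, `ratUnit_spec`/`ratUnit_unique`).  This is invariant under
refinement of the fraction (`pairUnit_comp`), hence descends to `O^×(A^birat)` (`ratHom`), is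
multiplicative (composition of fractions through a refinement square), injective (a fraction with
trivial unit part has `δ = ν`, since `Φ(Y_D)` is cancellative: subtract the two relations (d) of
Thm. 5.2 (i)) and surjective (for `b ∈ B(A_D)` write `Div_B(b) = c − d` with `c, d ∈ Φ(A_D)`; then
`b` is the unit part of the fraction `((1, id, d, 1), (1, id, c, b))` out of `(A_D, α − d)`,
`stdFrac`).  Compatibility with the divisor maps is `Div_B(u_ν/u_δ) = Div(ν) − Div(δ)`
(`ModelFrobenioid.divB_frac`) transported along `f⁻¹`; naturality along a linear `ψ : A → A'`
(Prop. 2.2 (ii)) is witnessed by the explicit square `l ≫ (1, id, d, 1) = (1, id, ψ^*d, 1) ≫ ψ`,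
`l = (1, Base ψ, Div ψ, u_ψ)`.
-/

namespace Literature.AlgebraicGeometry.Frobenioids

open CategoryTheory Opposite

universe w v u

namespace ModelFrobenioid

variable {D : Type u} [Category.{v} D] {Φ B : Dᵒᵖ ⥤ CommMonCat.{w}} {DivB : B ⟶ monoidGp Φ}

local notation "𝓕" => toElem Φ B DivB

/-! ### Units and cancellation in `B`, transport along base isomorphisms -/

section Transport

variable (hBg : Objectwise (fun M _ => IsGroupLike M) B)
include hBg

/-- Every `u ∈ B(Base X)` is a unit ("`B` group-like"). [cite: MochizukiFrdI2008, Thm. 5.2 p.100] -/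
theorem isUnit_B (X : ModelFrobenioid Φ B DivB) (b : B.obj (op X.base)) : IsUnit b :=
  (hBg X.base).isUnit b

/-- `B(X)` is cancellative. [cite: MochizukiFrdI2008, Thm. 5.2 p.100] -/
theorem mul_right_cancel_B {X : D} {a b c : B.obj (op X)} (h : a * c = b * c) : a = b := by
  haveI : IsCancelMul (B.obj (op X)) :=
    isIntegral_iff_isCancelMul.mp (hBg X).isPreDivisorial.isIntegral
  exact mul_right_cancel h

end Transport

/-- `B(f)` is injective for an isomorphism `f` of `D`. [cite: MochizukiFrdI2008, Thm. 5.2 p.100] -/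
theorem map_injective_of_isIso {X Y : D} (f : X ⟶ Y) [IsIso f] :
    Function.Injective (B.map f.op).hom := by
  intro a b h
  have := congrArg (B.map (inv f).op).hom h
  rwa [map_map_of_comp_eq_id B (IsIso.inv_hom_id f), map_map_of_comp_eq_id B (IsIso.inv_hom_id f)]
    at this

/-! ### The unit part of a pair of degree-one morphisms with a common base isomorphism -/

section PairUnit

variable (hBg : Objectwise (fun M _ => IsGroupLike M) B)

/-- For `δ, ν : Y → A` with `Base(δ)` an isomorphism: the element `B(Base δ)⁻¹(u_ν · u_δ⁻¹)` of
`B(A_D)` — the unit part of the "rational function `ν ∘ δ⁻¹`". [cite: MochizukiFrdI2008, Thm. 5.2(ii) p.101] -/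
noncomputable def pairUnit {Y A : ModelFrobenioid Φ B DivB} (δ ν : Y ⟶ A) [IsIso (baseMap δ)] :
    (B.obj (op A.base))ˣ :=
  Units.map (B.map (inv (baseMap δ)).op).hom (frac (isUnit_B hBg Y) ν δ)

/-- Defining property: `B(Base δ)(pairUnit δ ν) · u_δ = u_ν`. [cite: MochizukiFrdI2008, Thm. 5.2(ii) p.101] -/
theorem pairUnit_spec {Y A : ModelFrobenioid Φ B DivB} (δ ν : Y ⟶ A) [IsIso (baseMap δ)] :
    (B.map (baseMap δ).op).hom (pairUnit hBg δ ν : B.obj (op A.base)) * unit δ = unit ν := by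
  have h1 : ((frac (isUnit_B hBg Y) ν δ * unitU (isUnit_B hBg Y) δ : (B.obj (op Y.base))ˣ) :
      B.obj (op Y.base)) = unit ν := by
    rw [frac, div_mul_cancel, coe_unitU]
  rw [pairUnit, Units.coe_map, map_map_of_comp_eq_id B (IsIso.hom_inv_id _),
    ← h1, Units.val_mul, coe_unitU]

/-- Uniqueness: `B(Base δ)(r) · u_δ = u_ν` determines `r`. [cite: MochizukiFrdI2008, Thm. 5.2(ii) p.101] -/
theorem pairUnit_unique {Y A : ModelFrobenioid Φ B DivB} (δ ν : Y ⟶ A) [IsIso (baseMap δ)]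
    {r : B.obj (op A.base)} (hr : (B.map (baseMap δ).op).hom r * unit δ = unit ν) :
    r = (pairUnit hBg δ ν : B.obj (op A.base)) :=
  map_injective_of_isIso (baseMap δ)
    (mul_right_cancel_B hBg (hr.trans (pairUnit_spec hBg δ ν).symm))

/-- `pairUnit` depends only on the pair of morphisms. [cite: MochizukiFrdI2008, Thm. 5.2(ii) p.101] -/
theorem pairUnit_congr {Y A : ModelFrobenioid Φ B DivB} {δ δ' ν ν' : Y ⟶ A} [IsIso (baseMap δ)]
    [IsIso (baseMap δ')] (h₁ : δ = δ') (h₂ : ν = ν') : pairUnit hBg δ ν = pairUnit hBg δ' ν' := by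
  subst h₁ h₂
  rfl

/-- Invariance under refinement: for `ε : E → Y` with `Base(ε)` an isomorphism and `δ, ν` of
Frobenius degree `1`, the pair `(ε ≫ δ, ε ≫ ν)` has the same unit part.
[cite: MochizukiFrdI2008, Prop. 4.4 p.82] -/
theorem pairUnit_comp {E Y A : ModelFrobenioid Φ B DivB} (ε : E ⟶ Y) (δ ν : Y ⟶ A)
    [IsIso (baseMap δ)] [IsIso (baseMap ε)] [IsIso (baseMap (ε ≫ δ))]
    (hδ : degFr δ = 1) (hν : degFr ν = 1) :
    pairUnit hBg (ε ≫ δ) (ε ≫ ν) = pairUnit hBg δ ν := by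
  refine (Units.ext (pairUnit_unique hBg (ε ≫ δ) (ε ≫ ν) ?_)).symm
  rw [unit_comp, unit_comp, hδ, hν, PNat.one_coe, pow_one, baseMap_comp, op_comp,
    B.map_comp, CommMonCat.comp_apply, ← mul_assoc, ← map_mul, pairUnit_spec]

end PairUnit

/-! ### The unit part of a rational function -/

section RatUnit

variable (hBg : Objectwise (fun M _ => IsGroupLike M) B) {A : ModelFrobenioid Φ B DivB}

/-- The base isomorphism of the denominator of a fraction. [cite: MochizukiFrdI2008, Prop. 4.4(iv) p.83] -/
instance isIso_baseMap_den (p : PreFrobenioid.RatFrac 𝓕 A) : IsIso (baseMap p.den) := p.den_mem.2.2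

/-- The base isomorphism of the numerator of a fraction. [cite: MochizukiFrdI2008, Prop. 4.4(iv) p.83] -/
instance isIso_baseMap_num (p : PreFrobenioid.RatFrac 𝓕 A) : IsIso (baseMap p.num) := p.num_mem.2.2

/-- Denominators have Frobenius degree `1`. [cite: MochizukiFrdI2008, Prop. 4.4(iv) p.83] -/
theorem degFr_den (p : PreFrobenioid.RatFrac 𝓕 A) : degFr p.den = 1 := p.den_mem.2.1

/-- Numerators have Frobenius degree `1`. [cite: MochizukiFrdI2008, Prop. 4.4(iv) p.83] -/
theorem degFr_num (p : PreFrobenioid.RatFrac 𝓕 A) : degFr p.num = 1 := p.num_mem.2.1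

/-- Numerator and denominator have the same base. [cite: MochizukiFrdI2008, Prop. 4.4(iv) p.83] -/
theorem baseMap_num (p : PreFrobenioid.RatFrac 𝓕 A) : baseMap p.num = baseMap p.den := p.baseEq.symm

/-- The unit part `B(f)⁻¹(u_ν · u_δ⁻¹) ∈ B(A_D)` of a fraction `(δ, ν)` at `A`.
[cite: MochizukiFrdI2008, Thm. 5.2(ii) p.101] -/
noncomputable def ratUnit (p : PreFrobenioid.RatFrac 𝓕 A) : (B.obj (op A.base))ˣ :=
  pairUnit hBg p.den p.num

/-- The unit part is invariant under the refinement relation of fractions.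
[cite: MochizukiFrdI2008, Prop. 4.4 p.82] -/
theorem ratUnit_sound {p q : PreFrobenioid.RatFrac 𝓕 A} (h : PreFrobenioid.RatFrac.Rel p q) :
    ratUnit hBg p = ratUnit hBg q := by
  obtain ⟨E, ε, ε', hε, hε', h₁, h₂⟩ := h
  haveI : IsIso (baseMap ε) := hε.2.2
  haveI : IsIso (baseMap ε') := hε'.2.2
  haveI : IsIso (baseMap (ε ≫ p.den)) := by rw [baseMap_comp]; infer_instance
  haveI : IsIso (baseMap (ε' ≫ q.den)) := by rw [baseMap_comp]; infer_instance
  unfold ratUnit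
  rw [← pairUnit_comp hBg ε p.den p.num (degFr_den p) (degFr_num p),
    ← pairUnit_comp hBg ε' q.den q.num (degFr_den q) (degFr_num q)]
  exact pairUnit_congr hBg h₁ h₂

/-- The unit fraction has trivial unit part. [cite: MochizukiFrdI2008, Prop. 4.4(i) p.84] -/
theorem ratUnit_one (hF : PreFrobenioid.IsFrobenioid 𝓕) (A : ModelFrobenioid Φ B DivB) :
    ratUnit hBg (PreFrobenioid.RatFrac.one hF A) = 1 := by
  refine (Units.ext (pairUnit_unique hBg _ _ ?_)).symm
  rw [Units.val_one, map_one, one_mul]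
  rfl

/-- Multiplicativity: the unit part of a composite fraction (computed through a refinement
square) is the product of the unit parts. [cite: MochizukiFrdI2008, Prop. 4.4(i) p.84] -/
theorem ratUnit_mulWith (hF : PreFrobenioid.IsFrobenioid 𝓕) (p q : PreFrobenioid.RatFrac 𝓕 A)
    (R : PreFrobenioid.RatFrac.Refinement q p) :
    ratUnit hBg (PreFrobenioid.RatFrac.mulWith hF q p R) = ratUnit hBg p * ratUnit hBg q := by
  have hw : R.left ≫ q.num = R.right ≫ p.den := R.w
  have hb : baseMap R.left ≫ baseMap q.den = baseMap R.right ≫ baseMap p.den := by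
    rw [← baseMap_num q, ← baseMap_comp, hw, baseMap_comp]
  have hu : (B.map (baseMap R.left).op).hom (unit q.num) * unit R.left =
      (B.map (baseMap R.right).op).hom (unit p.den) * unit R.right := by
    have h := congrArg Hom.unit hw
    change unit (R.left ≫ q.num) = unit (R.right ≫ p.den) at h
    rwa [unit_comp, unit_comp, degFr_num, degFr_den, PNat.one_coe, pow_one, pow_one] at h
  have h1 : (B.map (baseMap R.left ≫ baseMap q.den).op).hom (ratUnit hBg q : B.obj (op A.base)) *
      (B.map (baseMap R.left).op).hom (unit q.den) =
        (B.map (baseMap R.left).op).hom (unit q.num) := by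
    rw [op_comp, B.map_comp, CommMonCat.comp_apply, ← map_mul]
    exact congrArg _ (pairUnit_spec hBg q.den q.num)
  have h2 : (B.map (baseMap R.left ≫ baseMap q.den).op).hom (ratUnit hBg p : B.obj (op A.base)) *
      (B.map (baseMap R.right).op).hom (unit p.den) =
        (B.map (baseMap R.right).op).hom (unit p.num) := by
    rw [hb, op_comp, B.map_comp, CommMonCat.comp_apply, ← map_mul]
    exact congrArg _ (pairUnit_spec hBg p.den p.num)
  symm
  apply Units.ext
  refine pairUnit_unique hBg _ _ ?_
  change (B.map (baseMap (R.left ≫ q.den)).op).hom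
      ((ratUnit hBg p : B.obj (op A.base)) * (ratUnit hBg q : B.obj (op A.base))) *
        unit (R.left ≫ q.den) = unit (R.right ≫ p.num)
  rw [map_mul, unit_comp, unit_comp, degFr_den, degFr_num, PNat.one_coe, pow_one, pow_one,
    baseMap_comp]
  calc (B.map (baseMap R.left ≫ baseMap q.den).op).hom (ratUnit hBg p : B.obj (op A.base)) *
        (B.map (baseMap R.left ≫ baseMap q.den).op).hom (ratUnit hBg q : B.obj (op A.base)) *
          ((B.map (baseMap R.left).op).hom (unit q.den) * unit R.left)
        = (B.map (baseMap R.left ≫ baseMap q.den).op).hom (ratUnit hBg p : B.obj (op A.base)) *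
          (((B.map (baseMap R.left ≫ baseMap q.den).op).hom (ratUnit hBg q : B.obj (op A.base)) *
            (B.map (baseMap R.left).op).hom (unit q.den)) * unit R.left) := by simp only [mul_assoc]
    _ = (B.map (baseMap R.left ≫ baseMap q.den).op).hom (ratUnit hBg p : B.obj (op A.base)) *
          ((B.map (baseMap R.right).op).hom (unit p.den) * unit R.right) := by rw [h1, hu]
    _ = (B.map (baseMap R.right).op).hom (unit p.num) * unit R.right := by rw [← mul_assoc, h2]

/-! ### Trivial unit part forces `δ = ν` -/

/-- A fraction with trivial unit part is the unit fraction: subtracting the relations (d) of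
Thm. 5.2 (i) for `δ` and `ν` gives `Div(δ) = Div(ν)` (`Φ(Y_D)` cancellative), so `δ = ν`.
[cite: MochizukiFrdI2008, Thm. 5.2(ii) p.102] -/
theorem rel_one_of_ratUnit_eq_one (hF : PreFrobenioid.IsFrobenioid 𝓕)
    (hΦd : Objectwise (fun M _ => IsDivisorial M) Φ) {p : PreFrobenioid.RatFrac 𝓕 A}
    (h : ratUnit hBg p = 1) : PreFrobenioid.RatFrac.Rel p (PreFrobenioid.RatFrac.one hF A) := by
  have hu : unit p.den = unit p.num := by
    have h' := pairUnit_spec hBg p.den p.num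
    change (B.map (baseMap p.den).op).hom (ratUnit hBg p : B.obj (op A.base)) * unit p.den =
      unit p.num at h'
    rwa [h, Units.val_one, map_one, one_mul] at h'
  have hd : div p.den = div p.num := by
    haveI : IsCancelMul (Φ.obj (op p.src.base)) :=
      isIntegral_iff_isCancelMul.mp (hΦd p.src.base).isPreDivisorial.isIntegral
    apply Algebra.GrothendieckGroup.of_injective
    have h₁ := rel p.den
    have h₂ := rel p.num
    rw [degFr_den] at h₁
    rw [degFr_num, baseMap_num, ← hu, ← h₁] at h₂
    exact (mul_left_cancel h₂).symm
  have hdn : p.den = p.num :=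
    hom_ext ((degFr_den p).trans (degFr_num p).symm) (baseMap_num p).symm hd hu
  refine ⟨p.src, 𝟙 _, p.den, PreFrobenioid.isCoAngularPreStep_id hF _, p.den_mem, ?_, ?_⟩
  · change 𝟙 _ ≫ p.den = p.den ≫ 𝟙 A
    rw [Category.id_comp, Category.comp_id]
  · change 𝟙 _ ≫ p.num = p.den ≫ 𝟙 A
    rw [Category.id_comp, Category.comp_id, hdn]

/-! ### Standard fractions: every `b ∈ B(A_D)` is a unit part -/

variable (A)

/-- The object `(A_D, α − d)`, `d ∈ Φ(A_D)`. [cite: MochizukiFrdI2008, Thm. 5.2(ii) p.102] -/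
def stdSrc (d : Φ.obj (op A.base)) : ModelFrobenioid Φ B DivB :=
  ⟨A.base, A.cls * (Algebra.GrothendieckGroup.of d)⁻¹⟩

/-- The pre-step `(1, id, d, 1) : (A_D, α − d) → (A_D, α)`. [cite: MochizukiFrdI2008, Thm. 5.2(ii) p.102] -/
def stdDen (d : Φ.obj (op A.base)) : stdSrc A d ⟶ A where
  degFr := 1
  base := 𝟙 A.base
  div := d
  unit := 1
  rel := by
    change (A.cls * (Algebra.GrothendieckGroup.of d)⁻¹) ^ ((1 : ℕ+) : ℕ) *
        Algebra.GrothendieckGroup.of d = pullGp Φ (𝟙 A.base) A.cls * divB Φ B DivB (op A.base) 1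
    rw [PNat.one_coe, pow_one, inv_mul_cancel_right, map_one, mul_one, pullGp_id]

/-- The pre-step `(1, id, c, b) : (A_D, α − d) → (A_D, α)` for `Div_B(b) = c − d`.
[cite: MochizukiFrdI2008, Thm. 5.2(ii) p.102] -/
def stdNum (c d : Φ.obj (op A.base)) (b : B.obj (op A.base))
    (hb : divB Φ B DivB (op A.base) b =
      Algebra.GrothendieckGroup.of c * (Algebra.GrothendieckGroup.of d)⁻¹) : stdSrc A d ⟶ A where
  degFr := 1
  base := 𝟙 A.base
  div := c
  unit := b
  rel := by
    change (A.cls * (Algebra.GrothendieckGroup.of d)⁻¹) ^ ((1 : ℕ+) : ℕ) *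
        Algebra.GrothendieckGroup.of c = pullGp Φ (𝟙 A.base) A.cls * divB Φ B DivB (op A.base) b
    rw [PNat.one_coe, pow_one, pullGp_id, hb, mul_assoc, mul_comm _⁻¹]

variable {A}

include hBg in
/-- `(1, id, d, 1)` is a co-angular pre-step (every morphism of a model Frobenioid is co-angular).
[cite: MochizukiFrdI2008, Thm. 5.2(ii) p.102] -/
theorem isCoAngularPreStep_stdDen (d : Φ.obj (op A.base)) :
    PreFrobenioid.IsCoAngularPreStep 𝓕 (stdDen A d) :=
  ⟨isCoAngular hBg _, rfl, show IsIso (𝟙 A.base) from inferInstance⟩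

include hBg in
/-- `(1, id, c, b)` is a co-angular pre-step. [cite: MochizukiFrdI2008, Thm. 5.2(ii) p.102] -/
theorem isCoAngularPreStep_stdNum (c d : Φ.obj (op A.base)) (b : B.obj (op A.base))
    (hb : divB Φ B DivB (op A.base) b =
      Algebra.GrothendieckGroup.of c * (Algebra.GrothendieckGroup.of d)⁻¹) :
    PreFrobenioid.IsCoAngularPreStep 𝓕 (stdNum A c d b hb) :=
  ⟨isCoAngular hBg _, rfl, show IsIso (𝟙 A.base) from inferInstance⟩

variable (A) in
/-- The *standard fraction* `((1, id, d, 1), (1, id, c, b))` at `A` with unit part `b`, for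
`Div_B(b) = c − d`. [cite: MochizukiFrdI2008, Thm. 5.2(ii) p.102] -/
def stdFrac (c d : Φ.obj (op A.base)) (b : B.obj (op A.base))
    (hb : divB Φ B DivB (op A.base) b =
      Algebra.GrothendieckGroup.of c * (Algebra.GrothendieckGroup.of d)⁻¹) :
    PreFrobenioid.RatFrac 𝓕 A :=
  ⟨stdSrc A d, stdDen A d, stdNum A c d b hb, isCoAngularPreStep_stdDen hBg d,
    isCoAngularPreStep_stdNum hBg c d b hb, rfl⟩

/-- The standard fraction for `b` has unit part `b`. [cite: MochizukiFrdI2008, Thm. 5.2(ii) p.102] -/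
theorem ratUnit_stdFrac (c d : Φ.obj (op A.base)) (b : B.obj (op A.base))
    (hb : divB Φ B DivB (op A.base) b =
      Algebra.GrothendieckGroup.of c * (Algebra.GrothendieckGroup.of d)⁻¹) :
    (ratUnit hBg (stdFrac hBg A c d b hb) : B.obj (op A.base)) = b := by
  refine (pairUnit_unique hBg _ _ ?_).symm
  change (B.map (𝟙 A.base).op).hom b * 1 = b
  rw [mul_one, map_id_apply_B]

/-- Every `b ∈ B(A_D)` is the unit part of some fraction (write `Div_B(b) = c − d`).
[cite: MochizukiFrdI2008, Thm. 5.2(ii) p.102] -/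
theorem exists_ratUnit_eq (b : B.obj (op A.base)) :
    ∃ p : PreFrobenioid.RatFrac 𝓕 A, (ratUnit hBg p : B.obj (op A.base)) = b := by
  obtain ⟨c, d, hcd⟩ := grothendieckGroup_exists_mul_of_eq_of (divB Φ B DivB (op A.base) b)
  exact ⟨stdFrac hBg A c d b (eq_mul_inv_of_mul_eq hcd), ratUnit_stdFrac hBg c d b _⟩

/-! ### Compatibility with the divisor maps -/

/-- `Div(ν ∘ δ⁻¹) = Div_B(unit part)`: the divisor map `O^×(A^birat) → Φ^gp(A)` of Prop. 4.4
(i)/(iii) on a fraction is `Div_B` of its unit part. [cite: MochizukiFrdI2008, Thm. 5.2(ii) p.101] -/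
theorem div_eq_divB_ratUnit (p : PreFrobenioid.RatFrac 𝓕 A) :
    PreFrobenioid.RatFrac.div p = divB Φ B DivB (op A.base) (ratUnit hBg p : B.obj (op A.base)) := by
  have hinv : inv (baseMap p.num) = inv (baseMap p.den) :=
    IsIso.inv_eq_of_hom_inv_id (by rw [baseMap_num]; exact IsIso.hom_inv_id _)
  change Algebra.GrothendieckGroup.of ((Φ.map (inv (baseMap p.num)).op).hom (div p.num)) /
      Algebra.GrothendieckGroup.of ((Φ.map (inv (baseMap p.den)).op).hom (div p.den)) =
    divB Φ B DivB (op A.base) ((B.map (inv (baseMap p.den)).op).hom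
      (frac (isUnit_B hBg p.src) p.num p.den : B.obj (op p.src.base)))
  rw [hinv, ← pullGp_divB, divB_frac _ p.num p.den (baseMap_num p)
    ((degFr_num p).trans (degFr_den p).symm), map_div, pullGp_of, pullGp_of]

end RatUnit

/-! ### The isomorphism `O^×(A^birat) ≅ B(A_D)` -/

section Iso

variable (hBg : Objectwise (fun M _ => IsGroupLike M) B)
  (hΦd : Objectwise (fun M _ => IsDivisorial M) Φ)
  (hF : PreFrobenioid.IsFrobenioid (toElem Φ B DivB))

/-- The unit-part homomorphism `O^×(A^birat) → B(A_D)^× `. [cite: MochizukiFrdI2008, Thm. 5.2(ii) p.101] -/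
noncomputable def ratHom (A : ModelFrobenioid Φ B DivB) :
    PreFrobenioid.BiratUnits 𝓕 hF A →* (B.obj (op A.base))ˣ where
  toFun := Quotient.lift (s := PreFrobenioid.RatFrac.setoid 𝓕 hF A) (ratUnit hBg)
    fun _ _ h => ratUnit_sound hBg h
  map_one' := by
    change ratUnit hBg (PreFrobenioid.RatFrac.one hF A) = 1
    exact ratUnit_one hBg hF A
  map_mul' u v := by
    obtain ⟨p, hp⟩ := PreFrobenioid.BiratUnits.mk_surjective (F := 𝓕) (hF := hF) (A := A) u
    obtain ⟨q, hq⟩ := PreFrobenioid.BiratUnits.mk_surjective (F := 𝓕) (hF := hF) (A := A) v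
    subst hp hq
    change ratUnit hBg (PreFrobenioid.RatFrac.mulWith hF q p
      (PreFrobenioid.RatFrac.someRefinement hF q p)) = ratUnit hBg p * ratUnit hBg q
    exact ratUnit_mulWith hBg hF p q _

/-- `ratHom [p] = ratUnit p`. [cite: MochizukiFrdI2008, Thm. 5.2(ii) p.101] -/
theorem ratHom_mk (A : ModelFrobenioid Φ B DivB) (p : PreFrobenioid.RatFrac 𝓕 A) :
    ratHom hBg hF A (PreFrobenioid.BiratUnits.mk hF p) = ratUnit hBg p := rfl

/-- The unit-part map `O^×(A^birat) → B(A_D)`. [cite: MochizukiFrdI2008, Thm. 5.2(ii) p.101] -/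
noncomputable def ratValHom (A : ModelFrobenioid Φ B DivB) :
    PreFrobenioid.BiratUnits 𝓕 hF A →* B.obj (op A.base) :=
  (Units.coeHom _).comp (ratHom hBg hF A)

include hΦd in
/-- The unit-part map is a bijection `O^×(A^birat) → B(A_D)`. [cite: MochizukiFrdI2008, Thm. 5.2(ii) p.101] -/
theorem ratValHom_bijective (A : ModelFrobenioid Φ B DivB) :
    Function.Bijective (ratValHom hBg hF A) := by
  constructor
  · have hinj : Function.Injective (ratHom hBg hF A) := by
      refine (injective_iff_map_eq_one _).mpr fun u hu => ?_
      obtain ⟨p, rfl⟩ := PreFrobenioid.BiratUnits.mk_surjective (F := 𝓕) (hF := hF) (A := A) u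
      rw [PreFrobenioid.BiratUnits.one_def]
      exact PreFrobenioid.BiratUnits.sound (rel_one_of_ratUnit_eq_one hBg hF hΦd hu)
    exact fun u v h => hinj (Units.ext h)
  · intro b
    obtain ⟨p, hp⟩ := exists_ratUnit_eq hBg b
    exact ⟨PreFrobenioid.BiratUnits.mk hF p, hp⟩

/-- **`B(A_D) ≅ O^×(A^birat)`** for every object `A` of the model Frobenioid.
[cite: MochizukiFrdI2008, Thm. 5.2(ii) p.101] -/
noncomputable def ratIso (A : ModelFrobenioid Φ B DivB) :
    B.obj (op A.base) ≃* PreFrobenioid.BiratUnits 𝓕 hF A :=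
  (MulEquiv.ofBijective (ratValHom hBg hF A) (ratValHom_bijective hBg hΦd hF A)).symm

/-- `ratIso b = [p]` iff `p` has unit part `b`. [cite: MochizukiFrdI2008, Thm. 5.2(ii) p.101] -/
theorem ratIso_eq_mk_iff (A : ModelFrobenioid Φ B DivB) (b : B.obj (op A.base))
    (p : PreFrobenioid.RatFrac 𝓕 A) :
    ratIso hBg hΦd hF A b = PreFrobenioid.BiratUnits.mk hF p ↔
      (ratUnit hBg p : B.obj (op A.base)) = b := by
  rw [ratIso, MulEquiv.symm_apply_eq, MulEquiv.ofBijective_apply]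
  exact eq_comm

/-- The unit part of `ratIso b` is `b`. [cite: MochizukiFrdI2008, Thm. 5.2(ii) p.101] -/
theorem ratValHom_ratIso (A : ModelFrobenioid Φ B DivB) (b : B.obj (op A.base)) :
    ratValHom hBg hF A (ratIso hBg hΦd hF A b) = b :=
  MulEquiv.apply_symm_apply (MulEquiv.ofBijective (ratValHom hBg hF A) _) b

/-- Compatibility with the divisor maps: `Div ∘ ratIso = Div_B`. [cite: MochizukiFrdI2008, Thm. 5.2(ii) p.101] -/
theorem divHom_ratIso (A : ModelFrobenioid Φ B DivB) (b : B.obj (op A.base)) :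
    PreFrobenioid.BiratUnits.divHom hF A (ratIso hBg hΦd hF A b) = divB Φ B DivB (op A.base) b := by
  obtain ⟨p, hp⟩ := PreFrobenioid.BiratUnits.mk_surjective (F := 𝓕) (hF := hF) (A := A) (ratIso hBg hΦd hF A b)
  rw [← hp, PreFrobenioid.BiratUnits.divHom_mk, div_eq_divB_ratUnit hBg p,
    (ratIso_eq_mk_iff hBg hΦd hF A b p).mp hp.symm]

/-! ### Naturality along linear morphisms -/

include hΦd in
/-- Naturality (Prop. 2.2 (ii)(a)(b)): along a linear `ψ : A → A'`, `B(Base ψ)(b')` corresponds to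
the `u` with `ψ ∘ u = b' ∘ ψ` in `C^birat` — witnessed by the square
`l ≫ (1, id, d, 1) = (1, id, ψ^*d, 1) ≫ ψ`, `l = (1, Base ψ, Div ψ, u_ψ)`, between the standard
fractions of `B(Base ψ)(b')` and of `b'`. [cite: MochizukiFrdI2008, Thm. 5.2(ii) p.101] -/
theorem ratIso_natural {A A' : ModelFrobenioid Φ B DivB} (ψ : A ⟶ A')
    (hψ : PreFrobenioid.IsLinear 𝓕 ψ) (b' : B.obj (op A'.base)) :
    PreFrobenioid.BiratUnits.Intertwines hF ψ
      (ratIso hBg hΦd hF A ((B.map (baseMap ψ).op).hom b')) (ratIso hBg hΦd hF A' b') := by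
  have hψ1 : degFr ψ = 1 := hψ
  obtain ⟨c, d, hcd⟩ := grothendieckGroup_exists_mul_of_eq_of (divB Φ B DivB (op A'.base) b')
  have hb' : divB Φ B DivB (op A'.base) b' =
      Algebra.GrothendieckGroup.of c * (Algebra.GrothendieckGroup.of d)⁻¹ :=
    eq_mul_inv_of_mul_eq hcd
  have hb : divB Φ B DivB (op A.base) ((B.map (baseMap ψ).op).hom b') =
      Algebra.GrothendieckGroup.of ((Φ.map (baseMap ψ).op).hom c) *
        (Algebra.GrothendieckGroup.of ((Φ.map (baseMap ψ).op).hom d))⁻¹ := by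
    rw [← pullGp_divB, hb', map_mul, map_inv, pullGp_of, pullGp_of]
  -- the connecting morphism `l = (1, Base ψ, Div ψ, u_ψ) : (A_D, α − ψ^*d) → (A'_D, α' − d)`
  let l : stdSrc A ((Φ.map (baseMap ψ).op).hom d) ⟶ stdSrc A' d :=
    { degFr := 1
      base := show A.base ⟶ A'.base from baseMap ψ
      div := show Φ.obj (op A.base) from div ψ
      unit := show B.obj (op A.base) from unit ψ
      rel := by
        have h := rel ψ
        rw [hψ1, PNat.one_coe, pow_one] at h
        change (A.cls * (Algebra.GrothendieckGroup.of ((Φ.map (baseMap ψ).op).hom d))⁻¹) ^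
            ((1 : ℕ+) : ℕ) * Algebra.GrothendieckGroup.of (div ψ) =
          pullGp Φ (baseMap ψ) (A'.cls * (Algebra.GrothendieckGroup.of d)⁻¹) *
            divB Φ B DivB (op A.base) (unit ψ)
        rw [PNat.one_coe, pow_one, map_mul, map_inv, pullGp_of, mul_right_comm, h,
          mul_right_comm] }
  refine ⟨stdFrac hBg A _ _ _ hb, stdFrac hBg A' c d b' hb', _, 𝟙 _, l,
    ((ratIso_eq_mk_iff hBg hΦd hF A _ _).mpr (ratUnit_stdFrac hBg _ _ _ hb)).symm,
    ((ratIso_eq_mk_iff hBg hΦd hF A' _ _).mpr (ratUnit_stdFrac hBg c d b' hb')).symm,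
    PreFrobenioid.isCoAngularPreStep_id hF _, ?_, ?_⟩
  · rw [Category.id_comp]
    refine hom_ext ?_ ?_ ?_ ?_
    · change (1 : ℕ+) * 1 = degFr ψ * 1
      rw [hψ1]
    · change baseMap ψ ≫ 𝟙 A'.base = 𝟙 A.base ≫ baseMap ψ
      rw [Category.comp_id, Category.id_comp]
    · change (Φ.map (baseMap ψ).op).hom d * div ψ ^ ((1 : ℕ+) : ℕ) =
        (Φ.map (𝟙 A.base).op).hom (div ψ) * ((Φ.map (baseMap ψ).op).hom d) ^ (degFr ψ : ℕ)
      rw [hψ1, PNat.one_coe, pow_one, pow_one, map_id_apply_Φ, mul_comm]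
    · change (B.map (baseMap ψ).op).hom 1 * unit ψ ^ ((1 : ℕ+) : ℕ) =
        (B.map (𝟙 A.base).op).hom (unit ψ) * 1 ^ (degFr ψ : ℕ)
      rw [map_one, one_mul, PNat.one_coe, pow_one, one_pow, mul_one, map_id_apply_B]
  · rw [Category.id_comp]
    refine hom_ext ?_ ?_ ?_ ?_
    · change (1 : ℕ+) * 1 = degFr ψ * 1
      rw [hψ1]
    · change baseMap ψ ≫ 𝟙 A'.base = 𝟙 A.base ≫ baseMap ψ
      rw [Category.comp_id, Category.id_comp]
    · change (Φ.map (baseMap ψ).op).hom c * div ψ ^ ((1 : ℕ+) : ℕ) =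
        (Φ.map (𝟙 A.base).op).hom (div ψ) * ((Φ.map (baseMap ψ).op).hom c) ^ (degFr ψ : ℕ)
      rw [hψ1, PNat.one_coe, pow_one, pow_one, map_id_apply_Φ, mul_comm]
    · change (B.map (baseMap ψ).op).hom b' * unit ψ ^ ((1 : ℕ+) : ℕ) =
        (B.map (𝟙 A.base).op).hom (unit ψ) * ((B.map (baseMap ψ).op).hom b') ^ (degFr ψ : ℕ)
      rw [hψ1, PNat.one_coe, pow_one, pow_one, map_id_apply_B, mul_comm]

/-- **`B` is the rational function monoid of the model Frobenioid** (the structure of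
`ModelFrobenioidComparison.lean`), for any Frobenioid structure `hF` on `C → F_Φ`, `B` group-like
and `Φ` divisorial. [cite: MochizukiFrdI2008, Thm. 5.2(ii) p.101] -/
noncomputable def rationalFunctionMonoidStr :
    PreFrobenioid.RationalFunctionMonoidStr 𝓕 hF B DivB where
  iso A := ratIso hBg hΦd hF A
  div_iso A b := divHom_ratIso hBg hΦd hF A b
  natural _ _ ψ hψ b' := ratIso_natural hBg hΦd hF ψ hψ b'

end Iso

variable (Φ B DivB) in
/-- **Thm. 5.2 (ii)**, last sentence — DISCHARGED: for the model Frobenioid of `(Φ, B, Div_B)`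
under the hypotheses of Thm. 5.2, `B` (with `Div_B`) is the rational function monoid `O^×(−)` of
`C^birat`, naturally and compatibly with the divisor maps. [cite: MochizukiFrdI2008, Thm. 5.2(ii) p.101] -/
theorem rationalFunctionMonoidIsB_holds : RationalFunctionMonoidIsB Φ B DivB :=
  fun h hF => ⟨rationalFunctionMonoidStr h.isGroupLike_rat h.isDivisorial hF⟩

end ModelFrobenioid

end Literature.AlgebraicGeometry.Frobenioids
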